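import Mathlib.RepresentationTheory.Homological.ContCohomology.Functoriality
import HarnessLib

/-!
# Transport of continuous cohomology along an isomorphism of topological groups

Topic `NumberTheory/GaloisRepresentations` (continuous cochain cohomology; Mathlib's
`continuousCohomology`); namespace `Literature.NumberTheory.GaloisRepresentations`.  One auxiliary
definition with body (the transport isomorphism) and theorems; no named fact.

For an isomorphism of topological groups `e : G ≃ₜ* H` and topological representations `X` of `G`,
`Y` of `H` over the same coefficient ring which CORRESPOND under `e` — morphisms
`φ : res e⁻¹ X ⟶ Y`, `ψ : res e Y ⟶ X` with `ψ ∘ φ = id_X` (and `φ ∘ ψ = id_Y`) — the maps induced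
on continuous cohomology, `Hⁿ(e⁻¹, φ) : Hⁿ(G, X) → Hⁿ(H, Y)` and `Hⁿ(e, ψ) : Hⁿ(H, Y) → Hⁿ(G, X)`,
are mutually inverse (`map_comp`, `map_id`).  This is the (trivial) functoriality statement
"isomorphic profinite groups with isomorphic coefficients have isomorphic cohomology" (Serre,
*Galois Cohomology* I §2.4, compatible pairs; Neukirch–Schmidt–Wingberg I §5), packaged once so that
invariants defined through `continuousCohomology` (torsion exponents, finiteness, cardinalities,
ranks — e.g. the [AbsTopI] Thm 2.6 invariants `δʲ_l`) can be moved along `≃ₜ*` BY NAME; it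
generalises the private helpers of `AbsTopIThm26iiiTransportProofs` / `AbsTopIThm26iiiClauseOneProofs`
(abc-iut) to arbitrary coefficients and degrees.

* `ContinuousCohomology.map_eq_id_of_forall` — `Hⁿ(θ, F) = id` when `θ = id` and `F` is pointwise
  the identity;
* `map_symm_comp_map_of_continuousMulEquiv` — `Hⁿ(e⁻¹, φ) ≫ Hⁿ(e, ψ) = 𝟙` from `ψ ∘ φ = id`;
* `continuousCohomologyAddEquivOfContinuousMulEquiv e φ ψ hψφ hφψ n : Hⁿ(G, X) ≃+ Hⁿ(H, Y)`;
* consequences needing only `ψ ∘ φ = id` (so `Hⁿ(G, X)` is a retract of `Hⁿ(H, Y)`):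
  `map_injective_of_continuousMulEquiv`, `nsmul_continuousCohomology_eq_zero_of_continuousMulEquiv`
  (an integer killing `Hⁿ(H, Y)` kills `Hⁿ(G, X)`), `subsingleton_continuousCohomology_of_continuousMulEquiv`,
  `finite_continuousCohomology_of_continuousMulEquiv`; and with both identities
  `natCard_continuousCohomology_eq_of_continuousMulEquiv`.

## References
* J.-P. Serre, *Galois Cohomology* (1997), I §2.4 (compatible pairs, functoriality). [SerreGaloisCohomology1997]
* J. Neukirch, A. Schmidt, K. Wingberg, *Cohomology of Number Fields*, 2nd ed. (2008), I §5. [NeukirchSchmidtWingberg2008]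
-/

noncomputable section

open CategoryTheory

namespace Literature.NumberTheory.GaloisRepresentations

universe u v

variable {k : Type u} [Ring k] [TopologicalSpace k]
variable {G H : Type v} [Group G] [TopologicalSpace G] [IsTopologicalGroup G]
  [Group H] [TopologicalSpace H] [IsTopologicalGroup H]

/-- `Hⁿ(θ, F) = id` on `Hⁿ(H, X)` when `θ` is (equal to) the identity of `H` and `F` is pointwise
the identity of `X` (Mathlib's `ContinuousCohomology.map_id` after substitution).
[cite: SerreGaloisCohomology1997, I §2.4] -/
theorem ContinuousCohomology.map_eq_id_of_forall {X : TopRep k H} (θ : H →ₜ* H)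
    (F : TopRep.res (θ : H →* H) X ⟶ X) (hθ : θ = ContinuousMonoidHom.id H)
    (hF : ∀ x : X, F.hom x = x) (n : ℕ) :
    ContinuousCohomology.map θ F n = 𝟙 _ := by
  subst hθ
  have : F = 𝟙 X :=
    TopRep.hom_ext (ContIntertwiningMap.ext (ContinuousLinearMap.ext fun x => hF x))
  rw [this]
  exact ContinuousCohomology.map_id X n

variable (e : G ≃ₜ* H) {X : TopRep k G} {Y : TopRep k H}
  (φ : TopRep.res ((e.symm : H →ₜ* G) : H →* G) X ⟶ Y)
  (ψ : TopRep.res ((e : G →ₜ* H) : G →* H) Y ⟶ X)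

/-- **`Hⁿ(e⁻¹, φ) ≫ Hⁿ(e, ψ) = 𝟙_{Hⁿ(G, X)}`** when `ψ ∘ φ = id_X` (`e : G ≃ₜ* H`,
`φ : res e⁻¹ X ⟶ Y`, `ψ : res e Y ⟶ X`). [cite: SerreGaloisCohomology1997, I §2.4] -/
theorem map_symm_comp_map_of_continuousMulEquiv (hψφ : ∀ x : X, ψ.hom (φ.hom x) = x) (n : ℕ) :
    ContinuousCohomology.map (e.symm : H →ₜ* G) φ n ≫ ContinuousCohomology.map (e : G →ₜ* H) ψ n =
      𝟙 _ := by
  rw [← ContinuousCohomology.map_comp]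
  refine ContinuousCohomology.map_eq_id_of_forall _ _ ?_ (fun x => hψφ x) n
  ext g
  simp

/-- `Hⁿ(e, ψ) (Hⁿ(e⁻¹, φ) x) = x` for `x ∈ Hⁿ(G, X)` when `ψ ∘ φ = id_X`.
[cite: SerreGaloisCohomology1997, I §2.4] -/
theorem map_map_symm_apply_of_continuousMulEquiv (hψφ : ∀ x : X, ψ.hom (φ.hom x) = x) (n : ℕ)
    (x : continuousCohomology n X) :
    (ContinuousCohomology.map (e : G →ₜ* H) ψ n).hom
      ((ContinuousCohomology.map (e.symm : H →ₜ* G) φ n).hom x) = x := by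
  have h := congr_arg (fun f => f.hom x) (map_symm_comp_map_of_continuousMulEquiv e φ ψ hψφ n)
  simpa using h

/-- `Hⁿ(e⁻¹, φ) (Hⁿ(e, ψ) y) = y` for `y ∈ Hⁿ(H, Y)` when `φ ∘ ψ = id_Y`.
[cite: SerreGaloisCohomology1997, I §2.4] -/
theorem map_symm_map_apply_of_continuousMulEquiv (hφψ : ∀ y : Y, φ.hom (ψ.hom y) = y) (n : ℕ)
    (y : continuousCohomology n Y) :
    (ContinuousCohomology.map (e.symm : H →ₜ* G) φ n).hom
      ((ContinuousCohomology.map (e : G →ₜ* H) ψ n).hom y) = y := by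
  -- the same statement for `e.symm : H ≃ₜ* G` (note `e.symm.symm = e`)
  have h := map_symm_comp_map_of_continuousMulEquiv (k := k) e.symm ψ φ hφψ n
  have h' := congr_arg (fun f => f.hom y) h
  simpa using h'

/-- **`Hⁿ(G, X) ≃+ Hⁿ(H, Y)` along `e : G ≃ₜ* H`** for representations corresponding under `e`
(`ψ ∘ φ = id_X`, `φ ∘ ψ = id_Y`): `x ↦ Hⁿ(e⁻¹, φ) x`, inverse `y ↦ Hⁿ(e, ψ) y`.
[cite: SerreGaloisCohomology1997, I §2.4] -/
def continuousCohomologyAddEquivOfContinuousMulEquiv (hψφ : ∀ x : X, ψ.hom (φ.hom x) = x)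
    (hφψ : ∀ y : Y, φ.hom (ψ.hom y) = y) (n : ℕ) :
    continuousCohomology n X ≃+ continuousCohomology n Y where
  toFun x := (ContinuousCohomology.map (e.symm : H →ₜ* G) φ n).hom x
  invFun y := (ContinuousCohomology.map (e : G →ₜ* H) ψ n).hom y
  left_inv x := map_map_symm_apply_of_continuousMulEquiv e φ ψ hψφ n x
  right_inv y := map_symm_map_apply_of_continuousMulEquiv e φ ψ hφψ n y
  map_add' x x' := map_add _ x x'

/-- Unfolding the transport equivalence. [cite: SerreGaloisCohomology1997, I §2.4] -/
@[simp] theorem continuousCohomologyAddEquivOfContinuousMulEquiv_apply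
    (hψφ : ∀ x : X, ψ.hom (φ.hom x) = x) (hφψ : ∀ y : Y, φ.hom (ψ.hom y) = y) (n : ℕ)
    (x : continuousCohomology n X) :
    continuousCohomologyAddEquivOfContinuousMulEquiv e φ ψ hψφ hφψ n x =
      (ContinuousCohomology.map (e.symm : H →ₜ* G) φ n).hom x := rfl

/-- Unfolding the inverse of the transport equivalence. [cite: SerreGaloisCohomology1997, I §2.4] -/
@[simp] theorem continuousCohomologyAddEquivOfContinuousMulEquiv_symm_apply
    (hψφ : ∀ x : X, ψ.hom (φ.hom x) = x) (hφψ : ∀ y : Y, φ.hom (ψ.hom y) = y) (n : ℕ)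
    (y : continuousCohomology n Y) :
    (continuousCohomologyAddEquivOfContinuousMulEquiv e φ ψ hψφ hφψ n).symm y =
      (ContinuousCohomology.map (e : G →ₜ* H) ψ n).hom y := rfl

/-! ### Consequences needing only `ψ ∘ φ = id_X` (`Hⁿ(G, X)` is a retract of `Hⁿ(H, Y)`) -/

/-- `Hⁿ(e⁻¹, φ) : Hⁿ(G, X) → Hⁿ(H, Y)` is injective when `ψ ∘ φ = id_X`. [cite: SerreGaloisCohomology1997, I §2.4] -/
theorem map_injective_of_continuousMulEquiv (hψφ : ∀ x : X, ψ.hom (φ.hom x) = x) (n : ℕ) :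
    Function.Injective (ContinuousCohomology.map (e.symm : H →ₜ* G) φ n).hom :=
  Function.LeftInverse.injective (map_map_symm_apply_of_continuousMulEquiv e φ ψ hψφ n)

/-- **An integer killing `Hⁿ(H, Y)` kills `Hⁿ(G, X)`** when `X`, `Y` correspond under `e : G ≃ₜ* H`
(`ψ ∘ φ = id_X` suffices). [cite: SerreGaloisCohomology1997, I §2.4] -/
theorem nsmul_continuousCohomology_eq_zero_of_continuousMulEquiv
    (hψφ : ∀ x : X, ψ.hom (φ.hom x) = x) (n : ℕ) {m : ℕ}
    (hm : ∀ y : continuousCohomology n Y, m • y = 0) (x : continuousCohomology n X) : m • x = 0 := by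
  rw [← map_map_symm_apply_of_continuousMulEquiv e φ ψ hψφ n x, ← map_nsmul, hm, map_zero]

/-- `Hⁿ(H, Y) = 0 ⟹ Hⁿ(G, X) = 0` when `X`, `Y` correspond under `e : G ≃ₜ* H` (`ψ ∘ φ = id_X`
suffices). [cite: SerreGaloisCohomology1997, I §2.4] -/
theorem subsingleton_continuousCohomology_of_continuousMulEquiv
    (hψφ : ∀ x : X, ψ.hom (φ.hom x) = x) (n : ℕ) [Subsingleton (continuousCohomology n Y)] :
    Subsingleton (continuousCohomology n X) :=
  (map_injective_of_continuousMulEquiv e φ ψ hψφ n).subsingleton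

/-- `Hⁿ(H, Y)` finite `⟹ Hⁿ(G, X)` finite when `X`, `Y` correspond under `e : G ≃ₜ* H` (`ψ ∘ φ = id_X`
suffices). [cite: SerreGaloisCohomology1997, I §2.4] -/
theorem finite_continuousCohomology_of_continuousMulEquiv
    (hψφ : ∀ x : X, ψ.hom (φ.hom x) = x) (n : ℕ) [Finite (continuousCohomology n Y)] :
    Finite (continuousCohomology n X) :=
  Finite.of_injective _ (map_injective_of_continuousMulEquiv e φ ψ hψφ n)

/-- **`#Hⁿ(G, X) = #Hⁿ(H, Y)`** for representations corresponding under `e : G ≃ₜ* H`.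
[cite: SerreGaloisCohomology1997, I §2.4] -/
theorem natCard_continuousCohomology_eq_of_continuousMulEquiv
    (hψφ : ∀ x : X, ψ.hom (φ.hom x) = x) (hφψ : ∀ y : Y, φ.hom (ψ.hom y) = y) (n : ℕ) :
    Nat.card (continuousCohomology n X) = Nat.card (continuousCohomology n Y) :=
  Nat.card_congr (continuousCohomologyAddEquivOfContinuousMulEquiv e φ ψ hψφ hφψ n).toEquiv

end Literature.NumberTheory.GaloisRepresentations

end
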